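/-
Copyright (c) 2026 the pub-hodgecm-mathlib formalisation cell (harness21).  Prover seat hodgecm-mathlib-K2Liu-p14 (g2), Track B «K2-LIT»,
#184♮ = hLiu418 = `stmt-HodgeConjecture-24832`; Road Φ ∕ socket #41, organ G5-a (Φ7-2), face (β0), consumption side: the input (β0-ext) `hWext` of ★ (β0-3)
`K2LiuMiddleInnerSectionFlatCoords.exists_flat_coords` ∕ ★ (β0-4) `K2LiuMiddleCellPackageOfFaces` (LEAD BATCH #5; K2Liu-p14 (g2) 11:53Z announcement «(β0-ext) next»).
-/
import Summits.HodgeConjecture.HodgeConjecture.Theorems.K2LiuGL2GodementSectionsExhaustGlobal   -- ★ (β4-iii): `glDiagonal` letters, ★ Iwasawa `exists_borel_mul_standardMaximalCompactGL`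
import Literature.NumberTheory.Automorphic.IwasawaHaarGL2                                      -- ★ `borelDiagGL2`, `coe_borelDiagGL2_fst∕snd`, `continuous_borelDiagGL2`, `mem_standardParabolicGL_fin_two_iff`
import HarnessLib

/-!
# Crux `HLiu418`, Road Φ, organ G5-a, face (β0-ext): FLAT STANDARD SECTIONS OF `GL₂(𝔸_L)` THROUGH A `K`-TYPE — every `B : K → ℂ` with the `B ∩ K`-law
# `B(p k) = B(k)` (`p ∈ K` upper triangular) EXTENDS to a family `b_s` on `GL₂(𝔸_L)` with the flat torus law `|d₀|^{s+½}|d₁|^{−(s+½)}`, unipotent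
# invariance and `b_s|_K = B` (the `hWext` binder of ★ (β0-3)∕(β0-4))

Cell `hodgecm-mathlib`, crux item hLiu418 = `stmt-HodgeConjecture-24832`; squad K2 ∕ K2Liu; prover K2Liu-p14 (g2).  THEOREMS ONLY (no `def`, no instance, no
notation, no named-fact hypothesis, no `sorry`); lane `--supports stmt-HodgeConjecture-24832 --as helper`.

MECHANISM (Iwasawa bookkeeping).  Write `g = p·k` (★ `exists_borel_mul_standardMaximalCompactGL`), `p` upper triangular with diagonal units `(d₀(p), d₁(p)) = borelDiagGL2 p` (★), and set
`b_s(g) := |d₀(p)|^{s+½}|d₁(p)|^{−(s+½)}·B(k)`.  This is INDEPENDENT OF THE DECOMPOSITION: if `p k = p′ k′` then `q := p′⁻¹p = k′k⁻¹ ∈ B ∩ K`, so `B(k′) = B(q k) = B(k)` by the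
`B ∩ K`-law and `|dᵢ(p)| = |dᵢ(p′)|·|dᵢ(q)| = |dᵢ(p′)|` because **`|dᵢ(q)| = 1` on the compact group `B ∩ K`** (§2: a continuous homomorphism from a compact group to
`ℝ_{>0}` is trivial — ★ `ideleNorm_borelDiagGL2_eq_one` of `GL2BorelCoveringBox`).  Then the torus law, the unipotent invariance and `b_s|_K = B` are read off the decompositions
`diag(d)·g = (diag(d)p)·k`, `u·g = (up)·k`, `k = 1·k` (§3).
* §1 `glDiagonal_mem_standardParabolicGL`, `borelDiagGL2_glDiagonal`, `borelDiagGL2_unipotent` (diagonal units of `diag(d)` and of unipotents; products are ★ `borelDiagGL2_mul`);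
* §2 `flatValue_eq` (independence of the decomposition; `|dᵢ(q)| = 1` on `B ∩ K` is ★ `ideleNorm_borelDiagGL2_eq_one` of `GL2BorelCoveringBox`) and
  **`exists_flat_extension`** = the `hWext` binder of ★ `exists_flat_coords` for every `B` with the `B ∩ K`-law.
References: [Bump1997, §3.7 (flat sections, Iwasawa decomposition)]; [MoeglinWaldspurger1995, I.2.1, II.1.7]; [GelbartJacquet1979, §3].
HONEST LABEL.  Count-neutral helper: `HC_CM` is proved only modulo the 7 printed citations (2 remaining named inputs: hLiu418 = `stmt-HodgeConjecture-24832`,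
h413 = `stmt-HodgeConjecture-24833`) until rung 0 closes.
-/

set_option autoImplicit false
set_option linter.dupNamespace false -- the mandated namespace repeats `HodgeConjecture.HodgeConjecture`

noncomputable section

open MeasureTheory NumberField IsDedekindDomain Set Filter Topology
open scoped NNReal Matrix
open Literature.NumberTheory.Automorphic

namespace Summit.HodgeConjecture.HodgeConjecture.Cruxes.HLiu418.K2LiuGL2FlatExtension

/-! ## §1 Diagonal units of products of upper triangular matrices -/

section Algebra

variable {R : Type*} [CommRing R]

/-- the diagonal units of a product of upper triangular matrices, componentwise: `d₀(p p′) = d₀(p) d₀(p′)`, `d₁(p p′) = d₁(p) d₁(p′)`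
(the product form `borelDiagGL2 (p * p′) = …` is ★ `GL2BorelCoveringBox.borelDiagGL2_mul`, whose module is not in this file's import closure). [folklore] -/
theorem borelDiagGL2_fst_mul_snd_mul (p p' : ↥(standardParabolicGL R (id : Fin 2 → Fin 2))) :
    (borelDiagGL2 (p * p')).1 = (borelDiagGL2 p).1 * (borelDiagGL2 p').1 ∧ (borelDiagGL2 (p * p')).2 = (borelDiagGL2 p).2 * (borelDiagGL2 p').2 := by
  have hp10 : ((p' : GL (Fin 2) R) : Matrix (Fin 2) (Fin 2) R) 1 0 = 0 := mem_standardParabolicGL_fin_two_iff.1 p'.2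
  have hq10 : ((p : GL (Fin 2) R) : Matrix (Fin 2) (Fin 2) R) 1 0 = 0 := mem_standardParabolicGL_fin_two_iff.1 p.2
  refine ⟨Units.ext ?_, Units.ext ?_⟩
  · rw [Units.val_mul, coe_borelDiagGL2_fst, coe_borelDiagGL2_fst, coe_borelDiagGL2_fst, Subgroup.coe_mul, Units.val_mul, Matrix.mul_apply,
      Fin.sum_univ_two, hp10, mul_zero, add_zero]
  · rw [Units.val_mul, coe_borelDiagGL2_snd, coe_borelDiagGL2_snd, coe_borelDiagGL2_snd, Subgroup.coe_mul, Units.val_mul, Matrix.mul_apply,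
      Fin.sum_univ_two, hq10, zero_mul, zero_add]

/-- the diagonal units of `1`, componentwise. [folklore] -/
theorem borelDiagGL2_one_fst_snd : (borelDiagGL2 (1 : ↥(standardParabolicGL R (id : Fin 2 → Fin 2)))).1 = 1 ∧
    (borelDiagGL2 (1 : ↥(standardParabolicGL R (id : Fin 2 → Fin 2)))).2 = 1 := by
  refine ⟨Units.ext ?_, Units.ext ?_⟩
  · rw [coe_borelDiagGL2_fst, Subgroup.coe_one, Units.val_one, Matrix.one_apply_eq, Units.val_one]
  · rw [coe_borelDiagGL2_snd, Subgroup.coe_one, Units.val_one, Matrix.one_apply_eq, Units.val_one]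

/-- `diag(d)` is upper triangular. [folklore] -/
theorem glDiagonal_mem_standardParabolicGL (d : Fin 2 → Rˣ) : glDiagonal 2 R d ∈ standardParabolicGL R (id : Fin 2 → Fin 2) := by
  rw [mem_standardParabolicGL_fin_two_iff, coe_glDiagonal, Matrix.diagonal_apply_ne _ (by decide)]

/-- the diagonal units of `diag(d)` are `(d₀, d₁)`. [folklore] -/
theorem borelDiagGL2_glDiagonal (d : Fin 2 → Rˣ) :
    borelDiagGL2 (⟨glDiagonal 2 R d, glDiagonal_mem_standardParabolicGL d⟩ : ↥(standardParabolicGL R (id : Fin 2 → Fin 2))) = (d 0, d 1) := by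
  refine Prod.ext (Units.ext ?_) (Units.ext ?_)
  · rw [coe_borelDiagGL2_fst]
    change (glDiagonal 2 R d : Matrix (Fin 2) (Fin 2) R) 0 0 = _
    rw [coe_glDiagonal, Matrix.diagonal_apply_eq]
  · rw [coe_borelDiagGL2_snd]
    change (glDiagonal 2 R d : Matrix (Fin 2) (Fin 2) R) 1 1 = _
    rw [coe_glDiagonal, Matrix.diagonal_apply_eq]

/-- a unipotent upper triangular `u` (`u₁₀ = 0`, `u₀₀ = u₁₁ = 1`) is upper triangular with `d(u) = 1`. [folklore] -/
theorem borelDiagGL2_unipotent {u : GL (Fin 2) R} (hu10 : (u : Matrix (Fin 2) (Fin 2) R) 1 0 = 0) (hu00 : (u : Matrix (Fin 2) (Fin 2) R) 0 0 = 1)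
    (hu11 : (u : Matrix (Fin 2) (Fin 2) R) 1 1 = 1) :
    borelDiagGL2 (⟨u, mem_standardParabolicGL_fin_two_iff.2 hu10⟩ : ↥(standardParabolicGL R (id : Fin 2 → Fin 2))) = 1 := by
  refine Prod.ext (Units.ext ?_) (Units.ext ?_)
  · rw [coe_borelDiagGL2_fst, Prod.fst_one, Units.val_one]
    exact hu00
  · rw [coe_borelDiagGL2_snd, Prod.snd_one, Units.val_one]
    exact hu11

end Algebra

/-! ## §2 `|d₀(q)| = |d₁(q)| = 1` on the compact group `B ∩ K` -/

section NormOne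

/-- **a continuous homomorphism from a compact subgroup to `ℝ_{>0}` is trivial** (its image is a bounded subgroup; the argument of ★ `ideleNorm_det_eq_one_of_isCompact`).
[folklore] -/
theorem eq_one_of_isCompact_of_continuous {G : Type*} [Group G] [TopologicalSpace G] (φ : G →* ℝ≥0) (hφ : Continuous φ) (hne : ∀ g, φ g ≠ 0)
    {U₀ : Subgroup G} (hU₀ : IsCompact (U₀ : Set G)) {u : G} (hu : u ∈ U₀) : φ u = 1 := by
  obtain ⟨B, hB⟩ := (hU₀.image hφ).bddAbove
  have hbound : ∀ w ∈ U₀, (φ w : ℝ) ≤ B := fun w hw => by exact_mod_cast hB ⟨w, hw, rfl⟩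
  have hle : ∀ w ∈ U₀, (φ w : ℝ) ≤ 1 := by
    intro w hw
    by_contra hlt
    rw [not_le] at hlt
    obtain ⟨k, hk⟩ := pow_unbounded_of_one_lt (B : ℝ) hlt
    have := hbound (w ^ k) (U₀.pow_mem hw k)
    rw [map_pow, NNReal.coe_pow] at this
    exact absurd (hk.trans_le this) (lt_irrefl _)
  have hinv : (φ u⁻¹ : ℝ) = (φ u : ℝ)⁻¹ := by
    have h1 : φ u⁻¹ * φ u = 1 := by rw [← map_mul, inv_mul_cancel, map_one]
    exact_mod_cast eq_inv_of_mul_eq_one_left h1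
  have h1 := hle u hu
  have h2 := hle u⁻¹ (U₀.inv_mem hu)
  rw [hinv] at h2
  have hpos : (0 : ℝ) < φ u := NNReal.coe_pos.2 (pos_iff_ne_zero.2 (hne u))
  have hge : (1 : ℝ) ≤ φ u := by
    have := mul_le_mul_of_nonneg_right h2 hpos.le
    rwa [inv_mul_cancel₀ hpos.ne', one_mul] at this
  exact_mod_cast le_antisymm h1 hge

variable {L : Type} [Field L] [NumberField L]

/-- **`|d₀(q)|_𝔸 = 1` and `|d₁(q)|_𝔸 = 1` FOR UPPER TRIANGULAR `q ∈ K`**: the diagonal-unit maps are continuous homomorphisms on the compact group `B ∩ K` (closed in `K`)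
(cf. ★ `GL2BorelCoveringBox.ideleNorm_borelDiagGL2_eq_one`, stated on `borelCompactPartGL2`; that module is not in this file's import closure). [cite: Bump1997, §3.7]
[cite: MoeglinWaldspurger1995, I.2.1] -/
theorem ideleNorm_borelDiag_eq_one_of_mem_maximalCompact (q : ↥(standardParabolicGL (AdeleRing (𝓞 L) L) (id : Fin 2 → Fin 2)))
    (hq : (q : GL (Fin 2) (AdeleRing (𝓞 L) L)) ∈ standardMaximalCompactGL 2 L) :
    IdeleClassGroup.ideleNorm L (borelDiagGL2 q).1 = 1 ∧ IdeleClassGroup.ideleNorm L (borelDiagGL2 q).2 = 1 := by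
  haveI : T2Space (AdeleRing (𝓞 L) L) := t2Space_adeleRing L
  -- the compact subgroup `B ∩ K` of `B`
  set U₀ : Subgroup ↥(standardParabolicGL (AdeleRing (𝓞 L) L) (id : Fin 2 → Fin 2)) :=
    (standardMaximalCompactGL 2 L).comap (standardParabolicGL (AdeleRing (𝓞 L) L) (id : Fin 2 → Fin 2)).subtype with hU₀
  have hmem : q ∈ U₀ := hq
  have hcpt : IsCompact (U₀ : Set ↥(standardParabolicGL (AdeleRing (𝓞 L) L) (id : Fin 2 → Fin 2))) := by
    have hce : Topology.IsClosedEmbedding (Subtype.val : ↥(standardParabolicGL (AdeleRing (𝓞 L) L) (id : Fin 2 → Fin 2)) → GL (Fin 2) (AdeleRing (𝓞 L) L)) :=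
      (isClosed_standardParabolicGL_id (R := AdeleRing (𝓞 L) L) (n := 2)).isClosedEmbedding_subtypeVal
    exact hce.isCompact_preimage (isCompact_standardMaximalCompactGL 2 L)
  -- the two diagonal-unit homomorphisms
  let δ : ↥(standardParabolicGL (AdeleRing (𝓞 L) L) (id : Fin 2 → Fin 2)) →* (AdeleRing (𝓞 L) L)ˣ × (AdeleRing (𝓞 L) L)ˣ :=
    { toFun := borelDiagGL2
      map_one' := Prod.ext borelDiagGL2_one_fst_snd.1 borelDiagGL2_one_fst_snd.2
      map_mul' := fun b b' => Prod.ext (borelDiagGL2_fst_mul_snd_mul b b').1 (borelDiagGL2_fst_mul_snd_mul b b').2 }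
  have hδc : Continuous δ := continuous_borelDiagGL2
  have h0 := eq_one_of_isCompact_of_continuous ((IdeleClassGroup.ideleNorm L).comp ((MonoidHom.fst _ _).comp δ))
    ((continuous_ideleNorm_holds L).comp (continuous_fst.comp hδc)) (fun g => ideleNorm_ne_zero _) hcpt hmem
  have h1 := eq_one_of_isCompact_of_continuous ((IdeleClassGroup.ideleNorm L).comp ((MonoidHom.snd _ _).comp δ))
    ((continuous_ideleNorm_holds L).comp (continuous_snd.comp hδc)) (fun g => ideleNorm_ne_zero _) hcpt hmem
  exact ⟨h0, h1⟩

end NormOne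

/-! ## §3 The flat extension -/

section Extension

variable {L : Type} [Field L] [NumberField L]

/-- **INDEPENDENCE OF THE IWASAWA DECOMPOSITION**: if `p k = p′ k′` (`p, p′` upper triangular, `k, k′ ∈ K`) and `B` has the `B ∩ K`-law, then
`|d₀(p)|^e |d₁(p)|^{e′} B(k) = |d₀(p′)|^e |d₁(p′)|^{e′} B(k′)`. [cite: Bump1997, §3.7] -/
theorem flatValue_eq (B : ↥(standardMaximalCompactGL 2 L) → ℂ)
    (hB : ∀ p k : ↥(standardMaximalCompactGL 2 L), ((p : GL (Fin 2) (AdeleRing (𝓞 L) L)) : Matrix (Fin 2) (Fin 2) (AdeleRing (𝓞 L) L)) 1 0 = 0 → B (p * k) = B k)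
    (e e' : ℂ) {p p' : ↥(standardParabolicGL (AdeleRing (𝓞 L) L) (id : Fin 2 → Fin 2))} {k k' : GL (Fin 2) (AdeleRing (𝓞 L) L)}
    (hk : k ∈ standardMaximalCompactGL 2 L) (hk' : k' ∈ standardMaximalCompactGL 2 L)
    (h : (p : GL (Fin 2) (AdeleRing (𝓞 L) L)) * k = (p' : GL (Fin 2) (AdeleRing (𝓞 L) L)) * k') :
    ((IdeleClassGroup.ideleNorm L (borelDiagGL2 p).1 : ℝ) : ℂ) ^ e * ((IdeleClassGroup.ideleNorm L (borelDiagGL2 p).2 : ℝ) : ℂ) ^ e' * B ⟨k, hk⟩ =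
      ((IdeleClassGroup.ideleNorm L (borelDiagGL2 p').1 : ℝ) : ℂ) ^ e * ((IdeleClassGroup.ideleNorm L (borelDiagGL2 p').2 : ℝ) : ℂ) ^ e' * B ⟨k', hk'⟩ := by
  -- `q := p′⁻¹ p = k′ k⁻¹ ∈ B ∩ K`
  set q : ↥(standardParabolicGL (AdeleRing (𝓞 L) L) (id : Fin 2 → Fin 2)) := p'⁻¹ * p with hq
  have hqk : (q : GL (Fin 2) (AdeleRing (𝓞 L) L)) = k' * k⁻¹ := by
    rw [hq, Subgroup.coe_mul, Subgroup.coe_inv, inv_mul_eq_iff_eq_mul, ← mul_inv_eq_iff_eq_mul.2 h.symm, mul_assoc]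
  have hqK : (q : GL (Fin 2) (AdeleRing (𝓞 L) L)) ∈ standardMaximalCompactGL 2 L := by
    rw [hqk]
    exact (standardMaximalCompactGL 2 L).mul_mem hk' ((standardMaximalCompactGL 2 L).inv_mem hk)
  obtain ⟨hq0, hq1⟩ := ideleNorm_borelDiag_eq_one_of_mem_maximalCompact q hqK
  -- `d(p) = d(p′) d(q)` and `|d(q)| = 1`
  have hpq : p = p' * q := by rw [hq, mul_inv_cancel_left]
  obtain ⟨hd0, hd1⟩ := borelDiagGL2_fst_mul_snd_mul p' q
  rw [hpq, hd0, hd1, map_mul, map_mul, hq0, hq1, mul_one, mul_one]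
  -- `B k′ = B (q k) = B k`
  have hk'eq : (⟨k', hk'⟩ : ↥(standardMaximalCompactGL 2 L)) = ⟨(q : GL (Fin 2) (AdeleRing (𝓞 L) L)), hqK⟩ * ⟨k, hk⟩ := by
    refine Subtype.ext ?_
    rw [Subgroup.coe_mul, hqk, inv_mul_cancel_right]
  rw [hk'eq, hB _ _ (mem_standardParabolicGL_fin_two_iff.1 q.2)]

/-- **(β0-ext) FLAT STANDARD SECTIONS THROUGH A `K`-TYPE**: every `B : K → ℂ` with `B(p k) = B(k)` for upper triangular `p ∈ K` extends to a family `b_s` on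
`GL₂(𝔸_L)` with the flat torus law `b_s(diag(d) g) = |d₀|^{s+½}|d₁|^{−(s+½)} b_s(g)`, unipotent invariance `b_s(u g) = b_s(g)` and `b_s|_K = B` — the `hWext`
binder of ★ (β0-3) `K2LiuMiddleInnerSectionFlatCoords.exists_flat_coords` and ★ (β0-4) `K2LiuMiddleCellPackageOfFaces`. [cite: Bump1997, §3.7] [cite: MoeglinWaldspurger1995, II.1.7] -/
theorem exists_flat_extension (B : ↥(standardMaximalCompactGL 2 L) → ℂ)
    (hB : ∀ p k : ↥(standardMaximalCompactGL 2 L), ((p : GL (Fin 2) (AdeleRing (𝓞 L) L)) : Matrix (Fin 2) (Fin 2) (AdeleRing (𝓞 L) L)) 1 0 = 0 → B (p * k) = B k) :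
    ∃ bB : ℂ → GL (Fin 2) (AdeleRing (𝓞 L) L) → ℂ,
      (∀ s : ℂ, 0 < s.re → ∀ (d : Fin 2 → (AdeleRing (𝓞 L) L)ˣ) (g : GL (Fin 2) (AdeleRing (𝓞 L) L)),
        bB s (glDiagonal 2 (AdeleRing (𝓞 L) L) d * g) =
          ((IdeleClassGroup.ideleNorm L (d 0) : ℝ) : ℂ) ^ (s + 1 / 2) * ((IdeleClassGroup.ideleNorm L (d 1) : ℝ) : ℂ) ^ (-(s + 1 / 2)) * bB s g) ∧
      (∀ s : ℂ, 0 < s.re → ∀ u g : GL (Fin 2) (AdeleRing (𝓞 L) L), (u : Matrix (Fin 2) (Fin 2) (AdeleRing (𝓞 L) L)) 1 0 = 0 →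
        (u : Matrix (Fin 2) (Fin 2) (AdeleRing (𝓞 L) L)) 0 0 = 1 → (u : Matrix (Fin 2) (Fin 2) (AdeleRing (𝓞 L) L)) 1 1 = 1 → bB s (u * g) = bB s g) ∧
      (∀ s : ℂ, 0 < s.re → ∀ (k : GL (Fin 2) (AdeleRing (𝓞 L) L)) (hk : k ∈ standardMaximalCompactGL 2 L), bB s k = B ⟨k, hk⟩) := by
  classical
  -- a chosen Iwasawa decomposition `g = p(g) · k(g)`
  choose pf hpf kf hkf hgf using fun g : GL (Fin 2) (AdeleRing (𝓞 L) L) => exists_borel_mul_standardMaximalCompactGL g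
  refine ⟨fun s g =>
      ((IdeleClassGroup.ideleNorm L (borelDiagGL2 (⟨pf g, hpf g⟩ : ↥(standardParabolicGL (AdeleRing (𝓞 L) L) (id : Fin 2 → Fin 2)))).1 : ℝ) : ℂ) ^ (s + 1 / 2) *
        ((IdeleClassGroup.ideleNorm L (borelDiagGL2 (⟨pf g, hpf g⟩ : ↥(standardParabolicGL (AdeleRing (𝓞 L) L) (id : Fin 2 → Fin 2)))).2 : ℝ) : ℂ) ^ (-(s + 1 / 2)) *
          B ⟨kf g, hkf g⟩,
    fun s _ d g => ?_, fun s _ u g hu10 hu00 hu11 => ?_, fun s _ k hk => ?_⟩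
  · -- torus law: `diag(d) · g = (diag(d) · p(g)) · k(g)`
    have hdec : ((⟨glDiagonal 2 (AdeleRing (𝓞 L) L) d, glDiagonal_mem_standardParabolicGL d⟩ * ⟨pf g, hpf g⟩ :
        ↥(standardParabolicGL (AdeleRing (𝓞 L) L) (id : Fin 2 → Fin 2))) : GL (Fin 2) (AdeleRing (𝓞 L) L)) * kf g =
          ((⟨pf (glDiagonal 2 (AdeleRing (𝓞 L) L) d * g), hpf _⟩ : ↥(standardParabolicGL (AdeleRing (𝓞 L) L) (id : Fin 2 → Fin 2))) :
            GL (Fin 2) (AdeleRing (𝓞 L) L)) * kf (glDiagonal 2 (AdeleRing (𝓞 L) L) d * g) := by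
      rw [Subgroup.coe_mul, mul_assoc, ← hgf g]
      exact hgf (glDiagonal 2 (AdeleRing (𝓞 L) L) d * g)
    dsimp only
    obtain ⟨hm0, hm1⟩ := borelDiagGL2_fst_mul_snd_mul (⟨glDiagonal 2 (AdeleRing (𝓞 L) L) d, glDiagonal_mem_standardParabolicGL d⟩ :
      ↥(standardParabolicGL (AdeleRing (𝓞 L) L) (id : Fin 2 → Fin 2))) ⟨pf g, hpf g⟩
    rw [← flatValue_eq B hB (s + 1 / 2) (-(s + 1 / 2)) (hkf g) (hkf _) hdec, hm0, hm1, borelDiagGL2_glDiagonal,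
      map_mul, map_mul, NNReal.coe_mul, NNReal.coe_mul, Complex.ofReal_mul, Complex.ofReal_mul,
      Complex.mul_cpow_ofReal_nonneg (NNReal.coe_nonneg _) (NNReal.coe_nonneg _), Complex.mul_cpow_ofReal_nonneg (NNReal.coe_nonneg _) (NNReal.coe_nonneg _)]
    ring
  · -- unipotent invariance: `u · g = (u · p(g)) · k(g)`, `d(u p) = d(p)`
    have hdec : ((⟨u, mem_standardParabolicGL_fin_two_iff.2 hu10⟩ * ⟨pf g, hpf g⟩ : ↥(standardParabolicGL (AdeleRing (𝓞 L) L) (id : Fin 2 → Fin 2))) :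
        GL (Fin 2) (AdeleRing (𝓞 L) L)) * kf g =
          ((⟨pf (u * g), hpf _⟩ : ↥(standardParabolicGL (AdeleRing (𝓞 L) L) (id : Fin 2 → Fin 2))) : GL (Fin 2) (AdeleRing (𝓞 L) L)) * kf (u * g) := by
      rw [Subgroup.coe_mul, mul_assoc, ← hgf g]
      exact hgf (u * g)
    dsimp only
    obtain ⟨hm0, hm1⟩ := borelDiagGL2_fst_mul_snd_mul (⟨u, mem_standardParabolicGL_fin_two_iff.2 hu10⟩ :
      ↥(standardParabolicGL (AdeleRing (𝓞 L) L) (id : Fin 2 → Fin 2))) ⟨pf g, hpf g⟩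
    rw [← flatValue_eq B hB (s + 1 / 2) (-(s + 1 / 2)) (hkf g) (hkf _) hdec, hm0, hm1, borelDiagGL2_unipotent hu10 hu00 hu11, Prod.fst_one, Prod.snd_one,
      one_mul, one_mul]
  · -- on `K`: `k = 1 · k`
    have hdec : ((1 : ↥(standardParabolicGL (AdeleRing (𝓞 L) L) (id : Fin 2 → Fin 2))) : GL (Fin 2) (AdeleRing (𝓞 L) L)) * k =
        ((⟨pf k, hpf _⟩ : ↥(standardParabolicGL (AdeleRing (𝓞 L) L) (id : Fin 2 → Fin 2))) : GL (Fin 2) (AdeleRing (𝓞 L) L)) * kf k := by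
      rw [Subgroup.coe_one, one_mul]
      exact hgf k
    dsimp only
    rw [← flatValue_eq B hB (s + 1 / 2) (-(s + 1 / 2)) hk (hkf _) hdec, borelDiagGL2_one_fst_snd.1, borelDiagGL2_one_fst_snd.2, map_one, NNReal.coe_one,
      Complex.ofReal_one, Complex.one_cpow, Complex.one_cpow, one_mul, one_mul]

end Extension

end Summit.HodgeConjecture.HodgeConjecture.Cruxes.HLiu418.K2LiuGL2FlatExtension

end
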